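import Literature.NumberTheory.LFunctions.ExceptionalCharacterTwinPrimes
import Literature.NumberTheory.LFunctions.LOneLowerBoundNonExceptional
import Literature.Barriers.Parity.SiegelZeroDichotomyNoSiegelZeros
import HarnessLib
import Summits.Parity.GeneralizedHardyLittlewood.Theorems.UnboundedSiegelZeros

/-!
# The Heath-Brown / Friedlander–Iwaniec hypothesis `η(D) → 0` lies on the Siegel-zero branch
# (a PROVED dictionary lemma for the «illusory world» column)

Everything in this file is PROVED (no new definition, no named fact). The column's hypotheses come in
two shapes: SMALL VALUES `η(D) = L(1,χ_D) log D ≤ ε` at arbitrarily large conductors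
(`Literature.NumberTheory.LFunctions.SmallEtaCharacters ε`, Friedlander–Iwaniec 2019 (1.6); Heath-Brown's
twin-prime theorem, Drappeau–Maynard, …) and REAL ZEROS of large quality
(`Literature.Barriers.Parity.UnboundedSiegelZeros`, Tao–Teräväinen's Definition 1.4; Granville,
Chinis, Matomäki–Merikoski, …). The tree proves `Strength A ⇒ SmallEta` (`A > 1`) and
`Strength 3 ⇒ UnboundedSiegelZeros`, but the passage FROM `∀ ε, SmallEtaCharacters ε` TO
`UnboundedSiegelZeros` was missing: the Hecke–Landau converse vendored in
`ExceptionalZeroOfSmallLOne.lean` needs `L(1,χ) = o(log^{−2} q)`. It follows, without producing the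
zero by hand, from two PROVED tree results:

* Hecke's theorem in the kernel form `NoExceptionalZeroUpTo.lfunction_one_re_ge` /
  `exists_lfunction_one_re_ge_of_noExceptionalZeroUpTo` (Montgomery–Vaughan Thm. 11.14, first case:
  a no-exceptional-zero table of width `c₀/log q` gives `Re L(1,χ) ≥ κ(c₀)/log q`, `κ` independent of
  the level), with `noSiegelZeros_iff_forall_noExceptionalZeroUpTo`; hence
  `NoSiegelZeros → ∃ ε₀ > 0, ¬ SmallEtaCharacters ε₀` (`exists_not_smallEtaCharacters_of_noSiegelZeros`);
* the dichotomy `noSiegelZeros_of_not_unboundedSiegelZeros` (`SiegelZeroDichotomyNoSiegelZeros.lean`);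
  hence **`(∀ ε > 0, SmallEtaCharacters ε) → UnboundedSiegelZeros`**
  (`unboundedSiegelZeros_of_forall_smallEtaCharacters`).

Consequently every `UnboundedSiegelZeros ⇒ X` entry of the column (Granville 2022, Chinis 2026,
Tao–Teräväinen's Cor. 1.8, …) also holds under the Heath-Brown / Friedlander–Iwaniec hypothesis
`∀ ε, η(D) ≤ ε infinitely often`, and every exit `X ⇒ NoSiegelZeros` refutes that hypothesis.

LABEL: instrument / statement layer (dictionary). WHAT THIS IS NOT: no hypothesis is asserted; the
converse `UnboundedSiegelZeros ⇒ ∀ ε SmallEtaCharacters ε` is NOT claimed (a zero of quality `η`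
only gives `η(D) ≪ log²D/η`, cf. `WrightPrimeTuples.StrongSiegelZeros.smallEtaCharacters`).

## References

* [FriedlanderIwaniec2019TwinPrimes] J. Friedlander, H. Iwaniec, Banach Center Publ. 118 (2019),
  (1.6) (`η(D)`), Corollary 1.1 «[Heath-Brown]».
* [TaoTeravainen2021] T. Tao, J. Teräväinen, JLMS 106 (2022), Definition 1.4.
* [MontgomeryVaughan2007] H. L. Montgomery, R. C. Vaughan, *Multiplicative Number Theory I*,
  Theorem 11.14 (first case), Theorem 11.4 (11.7) (Hecke's `L(1,χ) ≫ 1/log q` off the exceptional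
  case).
-/

noncomputable section

open Literature.Barriers.Parity

namespace Literature.NumberTheory.LFunctions

/-- A primitive character modulo `q ≥ 2` is not the trivial character (the trivial character has
conductor `1`). [folklore] -/
private theorem ne_one_of_isPrimitive_aux {q : ℕ} [NeZero q] (hq : 2 ≤ q)
    {χ : DirichletCharacter ℂ q} (hp : χ.IsPrimitive) : χ ≠ 1 := by
  rintro rfl
  have hcond : DirichletCharacter.conductor (1 : DirichletCharacter ℂ q) = q := hp
  rw [DirichletCharacter.conductor_one] at hcond
  omega

/-- **Hecke's theorem against the Friedlander–Iwaniec hypothesis**: under the tree's open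
`NoSiegelZeros` (rh.S34) there is an absolute `ε₀ > 0` with `η(D) = ‖L(1,χ)‖ log D > ε₀` for every
primitive quadratic `χ` of conductor `D ≥ 3` — i.e. `¬ SmallEtaCharacters ε₀`. (Kernel route:
`noSiegelZeros_iff_forall_noExceptionalZeroUpTo` + Montgomery–Vaughan Thm. 11.14, first case, as
`exists_lfunction_one_re_ge_of_noExceptionalZeroUpTo`.) [cite: MontgomeryVaughan2007, Theorem 11.4 (11.7) and Theorem 11.14 (first case)]
[cite: FriedlanderIwaniec2019TwinPrimes, (1.6)] -/
theorem exists_not_smallEtaCharacters_of_noSiegelZeros (h : NoSiegelZeros) :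
    ∃ ε₀ : ℝ, 0 < ε₀ ∧ ¬ SmallEtaCharacters ε₀ := by
  obtain ⟨c, hc, htab⟩ := noSiegelZeros_iff_forall_noExceptionalZeroUpTo.mp h
  obtain ⟨κ, hκ, hL⟩ := exists_lfunction_one_re_ge_of_noExceptionalZeroUpTo (c₀ := c) hc
  refine ⟨κ / 2, by positivity, fun hS => ?_⟩
  obtain ⟨D, hDne, χ, -, hD3, hprim, hquad, hη⟩ := hS 0
  haveI := hDne
  have hne : χ ≠ 1 := ne_one_of_isPrimitive_aux (by omega) hprim
  have hre := hL D (htab D) D hD3 le_rfl χ hquad hne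
  have hD3' : (3 : ℝ) ≤ D := by exact_mod_cast hD3
  have hlog : 0 < Real.log D := Real.log_pos (by linarith)
  -- `κ ≤ Re L(1,χ) · log D ≤ ‖L(1,χ)‖ log D ≤ κ/2`: absurd
  have h1 : κ ≤ (χ.LFunction 1).re * Real.log D := by
    have := (div_le_iff₀ hlog).mp hre
    linarith
  have h2 : (χ.LFunction 1).re ≤ ‖χ.LFunction 1‖ := Complex.re_le_norm _
  have h3 : (χ.LFunction 1).re * Real.log D ≤ ‖χ.LFunction 1‖ * Real.log D :=
    mul_le_mul_of_nonneg_right h2 hlog.le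
  linarith

/-- **The `η(D) → 0` hypothesis lies on the Siegel-zero branch of the dichotomy**: if for EVERY
`ε > 0` there are primitive quadratic characters of arbitrarily large conductor with
`‖L(1,χ)‖ log D ≤ ε` (the hypothesis of Heath-Brown's / Friedlander–Iwaniec's twin-prime theorem,
`FriedlanderIwaniec2019_corollary11`), then there are Siegel zeros of unbounded quality
(Tao–Teräväinen's `UnboundedSiegelZeros`) — by `exists_not_smallEtaCharacters_of_noSiegelZeros` and
the PROVED dichotomy `noSiegelZeros_of_not_unboundedSiegelZeros`. So every `UnboundedSiegelZeros ⇒ X`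
entry of the column holds under this hypothesis as well. [cite: FriedlanderIwaniec2019TwinPrimes, (1.6) and Corollary 1.1]
[cite: TaoTeravainen2021, Definition 1.4] -/
theorem unboundedSiegelZeros_of_forall_smallEtaCharacters
    (h : ∀ ε : ℝ, 0 < ε → SmallEtaCharacters ε) : Summit.Parity.GeneralizedHardyLittlewood.UnboundedSiegelZeros := by
  by_contra hU
  obtain ⟨ε₀, hε₀, hnot⟩ :=
    exists_not_smallEtaCharacters_of_noSiegelZeros (noSiegelZeros_of_not_unboundedSiegelZeros hU)
  exact hnot (h ε₀ hε₀)

/-- Equivalently: the `η(D) → 0` hypothesis refutes rh.S34 (`NoSiegelZeros`); any EXIT of the column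
(`X ⇒ NoSiegelZeros`: uniform Brun–Titchmarsh, weak Goldbach, interval sieve, uniform abc, …)
therefore refutes it too. [cite: FriedlanderIwaniec2019TwinPrimes, (1.6)] -/
theorem not_noSiegelZeros_of_forall_smallEtaCharacters
    (h : ∀ ε : ℝ, 0 < ε → SmallEtaCharacters ε) : ¬ NoSiegelZeros := fun hN => by
  obtain ⟨ε₀, hε₀, hnot⟩ := exists_not_smallEtaCharacters_of_noSiegelZeros hN
  exact hnot (h ε₀ hε₀)

/-- **Exceptional characters of any strength `A > 1` give Siegel zeros of unbounded quality** —
improving the tree's `unboundedSiegelZeros_of_exceptionalCharactersOfStrength` (which needs `A ≥ 3`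
because it produces the zero through the `log^{−2}`-converse): strength `A > 1` gives
`∀ ε, SmallEtaCharacters ε` (`smallEtaCharacters_of_exceptionalCharactersOfStrength`) and then
`unboundedSiegelZeros_of_forall_smallEtaCharacters` applies. [cite: FriedlanderIwaniec2019TwinPrimes, (1.6)]
[cite: TaoTeravainen2021, Definition 1.4] -/
theorem unboundedSiegelZeros_of_exceptionalCharactersOfStrength_gt_one {A : ℝ} (hA : 1 < A)
    (h : ExceptionalCharactersOfStrength A) : Summit.Parity.GeneralizedHardyLittlewood.UnboundedSiegelZeros :=
  unboundedSiegelZeros_of_forall_smallEtaCharacters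
    fun _ hε => smallEtaCharacters_of_exceptionalCharactersOfStrength hA h hε

/-- Hence `NoSiegelZeros` refutes every strength `A > 1` (the tree had this for `A ≥ 3`,
`not_exceptionalCharactersOfStrength_of_noSiegelZeros`). [cite: FriedlanderIwaniec2019TwinPrimes, (1.6)] -/
theorem not_exceptionalCharactersOfStrength_gt_one_of_noSiegelZeros (h : NoSiegelZeros) {A : ℝ}
    (hA : 1 < A) : ¬ ExceptionalCharactersOfStrength A := fun hE =>
  not_unboundedSiegelZeros_of_noSiegelZeros h
    (unboundedSiegelZeros_of_exceptionalCharactersOfStrength_gt_one hA hE)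

end Literature.NumberTheory.LFunctions

end
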